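import Mathlib
import HarnessLib
import Summits.HubbardSuperconductivity.HubbardSuperconductivity.Theorems.KLProgrammeKLRegimeSplitConsts

/-!
# Route `KLProgramme` — ENGINE child gen 8 (stmt-HubbardSuperconductivity-20437 `KLRegimeEngineV17F2`), SKELETON v2 base module:
# `EngConsts.withCR` — the engine package with ONLY the non-ladder cubic budget `CR` replaced
# (cell gate-hubbard-kl, seat p5 g6; plan g17 (R47)/(R47a)/(R47c)/(R47e), collision ruling KL STATUS 2026-08-27T13:55:38Z: ONE base module, imported by
# `…EngineV8TowerExports` (p5), `…EngineV8E5Share` (p5), `…EngineV8DefsG8` (k3c3-p2), `…EngineV8DefsQ8`/`…DefsU10` (k3c2-p1))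

The skeleton-v2 existence Props (`LevelsUStep`, `E5ShareStep`, `E4FlowAt`) quantify the history over the packages `Q₀.withCR r`, `r ≥ Q₀.CR`, so that
the deferred constants they define stay independent of the final package `klEngQ8 P R := (klEngQ7 P R).withCR (max (klEngQ7 P R).CR (klE5Raise P R))`
although it is built from them (the ∀r-device; CR only — every other field is untouched, so every `CE`/`S'`/`cE4`-reader is `rfl` across the raise).

* `EngConsts.withCR Q r := { Q with CR := r }`; `rfl` rows `withCR_CR/_CE/_c0/_cE4/_S'/_Bf/_SL/_CL/_L0/_M0`, `withCR_self`, `withCR_withCR`;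
* `withCR_wf` (`Q.WF → 0 ≤ r → (Q.withCR r).WF`), `withCR_wf_of_le` (`Q.WF → Q.CR ≤ r → …`), `CR_le_withCR_max_left/right`.

Definitions with bodies + bookkeeping; nothing about the model is asserted; nothing asserts superconductivity.
-/

noncomputable section

namespace Summit.HubbardSuperconductivity.HubbardSuperconductivity.Theorems.KLRegimeSplit

set_option linter.dupNamespace false -- summit = problem name (single-conjunct summit), D-0017

/-- **`Q.withCR r`** — the engine package `Q` with `CR := r`, every other field untouched. -/
def EngConsts.withCR (Q : EngConsts) (r : ℝ) : EngConsts := { Q with CR := r }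

namespace EngConsts

variable (Q : EngConsts) (r : ℝ)

/-- `(Q.withCR r).CR = r`. -/
@[simp] theorem withCR_CR : (Q.withCR r).CR = r := rfl
/-- untouched field `CE`. -/
@[simp] theorem withCR_CE : (Q.withCR r).CE = Q.CE := rfl
/-- untouched field `c0`. -/
@[simp] theorem withCR_c0 : (Q.withCR r).c0 = Q.c0 := rfl
/-- untouched field `cE4`. -/
@[simp] theorem withCR_cE4 : (Q.withCR r).cE4 = Q.cE4 := rfl
/-- untouched field `S'`. -/
@[simp] theorem withCR_S' : (Q.withCR r).S' = Q.S' := rfl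
/-- untouched field `Bf`. -/
@[simp] theorem withCR_Bf : (Q.withCR r).Bf = Q.Bf := rfl
/-- untouched field `SL`. -/
@[simp] theorem withCR_SL : (Q.withCR r).SL = Q.SL := rfl
/-- untouched field `CL`. -/
@[simp] theorem withCR_CL : (Q.withCR r).CL = Q.CL := rfl
/-- untouched field `L0`. -/
@[simp] theorem withCR_L0 : (Q.withCR r).L0 = Q.L0 := rfl
/-- untouched field `M0`. -/
@[simp] theorem withCR_M0 : (Q.withCR r).M0 = Q.M0 := rfl

/-- Replacing `CR` by itself does nothing. -/
theorem withCR_self : Q.withCR Q.CR = Q := rfl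

/-- Two replacements = the last one. -/
theorem withCR_withCR (r' : ℝ) : (Q.withCR r).withCR r' = Q.withCR r' := rfl

/-- `Q.CR ≤ (Q.withCR (max Q.CR x)).CR` — the raised package dominates the old budget. -/
theorem CR_le_withCR_max_left (x : ℝ) : Q.CR ≤ (Q.withCR (max Q.CR x)).CR := le_max_left _ _

/-- `x ≤ (Q.withCR (max Q.CR x)).CR` — the raised package dominates the raise. -/
theorem le_withCR_max_right (x : ℝ) : x ≤ (Q.withCR (max Q.CR x)).CR := le_max_right _ _

variable {Q r}

/-- **Replacing `CR` by a nonnegative value preserves well-formedness** (`CR` enters `EngConsts.WF` only through `0 ≤ CR`). -/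
theorem withCR_wf (hQ : Q.WF) (hr : 0 ≤ r) : (Q.withCR r).WF := by
  obtain ⟨h1, _, h3, h4, h5, h6, h7, h8⟩ := hQ
  exact ⟨h1, hr, h3, h4, h5, h6, h7, h8⟩

/-- Raising `CR` (`Q.CR ≤ r`) preserves well-formedness. -/
theorem withCR_wf_of_le (hQ : Q.WF) (hr : Q.CR ≤ r) : (Q.withCR r).WF := withCR_wf hQ (hQ.2.1.trans hr)

/-- The `max`-raise preserves well-formedness. -/
theorem withCR_max_wf (hQ : Q.WF) (x : ℝ) : (Q.withCR (max Q.CR x)).WF := withCR_wf_of_le hQ (le_max_left _ _)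

end EngConsts

end Summit.HubbardSuperconductivity.HubbardSuperconductivity.Theorems.KLRegimeSplit

end
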